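import Literature.AnabelianGeometry.EtaleTheta.Discharge.Sec5DictionaryAtThetaSetting
import Literature.AnabelianGeometry.EtaleTheta.Discharge.Sec5EnvelopeTopology

/-!
# [EtTh] Lemma 5.8 / Prop 5.2 (ii)(iii): F-1307 `CyclotomicCharacterCompat` (the `Π^tp_Ÿ`-form) AT THE JUNCTION `ofThetaSettingData`, from the
# `tf`-side constants dictionary — by restriction of abc-iut-L2-t11's F-1306 `Π^tp_X̲̲`-form

S. Mochizuki, *The étale theta function and its Frobenioid-theoretic manifestations*, Publ. RIMS **45** (2009), Lemma 5.8 proof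
p. 331 (PDF p. 105) ("`Π^tp_Y` [i.e., `G_K` …] acts … via multiplication by an element of `μ_N(B_N)`") [cite: MochizukiEtTh2009, Lem 5.8
p.331 (PDF p.105)].

abc-iut cell, D-0079 ORIGINAL-L / L-F [EtTh] (FACT row F-1307 `ThetaFrobenioid.CyclotomicCharacterCompat`; node `EtTh:Lem5.8`), seat
abc-iut-w6-d053 (gen 5), companion of the census `LF-ETTH-S5A.tsv` (row F-1307, corrected 17:0xZ: «INSTANCE-CONDITIONAL by composition —
`CyclotomicCharacterCompatX.toY`»).  PROOF-ONLY (0 definitions, no instance, no new `Prop`): abc-iut-L2-t11's F-1306 junction closer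
`cyclotomicCharacterCompatX_ofThetaSettingData_of_constantsDictionary` (`Discharge/Sec5DictionaryAtThetaSetting.lean`, the `Π^tp_X̲̲`-form)
restricted to `Π^tp_Ÿ̲` by abc-iut-L2-t11's `CyclotomicCharacterCompatX.toY` (`Discharge/Sec5EnvelopeTopology.lean`) — so the F-1307 HEAD
holds at the junction under EXACTLY the F-1306 residual {`hconst`, `hK`, `ν`, `hνμ`, `hνeq`}.  Nothing landed is edited or restated.
HONEST FRAMING: kernel re-keying; `tf` is an abstract parameter; nothing here bears on [IUTchIII] Cor. 3.12; no side taken; typed ≠ proved.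
-/

noncomputable section

namespace Literature.AnabelianGeometry.EtaleTheta

open CategoryTheory Opposite Literature.AlgebraicGeometry.Frobenioids Literature.AnabelianGeometry.SemiGraphs

universe v₀

namespace ThetaFrobenioid

section Junction

variable {p : ℕ} [Fact p.Prime] {D : ThetaSetting p} {E : D.EtaleThetaData} {l : ℕ} {C : E.DoubleUnderline l}
  {e : D.toTemperedCurve.GroupLevelData} {N : ℕ+} (μ : D.CyclotomeMod l N) (hC : D.Compat) (hS : D.Sec2Hyps)
  {D₀ : Type} [Category.{v₀} D₀] {V : FrdIMonoidStub.{0}} {T₀ : RealifiedDivisorMonoids (D₀ := D₀) V}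
  {VD : FrdICatStub.{1, 0, 0} (ConnectedPart (BTemp (C.temperedArithmeticGroup e).Pi))}
  {tf : TemperedFrobenioid T₀ (ConnectedPart (BTemp (C.temperedArithmeticGroup e).Pi)) VD} {hZ : tf.monoidType = MonoidType.Z}
  {hP : ∀ A : (ConnectedPart (BTemp (C.temperedArithmeticGroup e).Pi))ᵒᵖ, IsPerfect (tf.Φ.carrier A)}
  {NH : Subgroup (Field.absoluteGaloisGroup D.K) → tf.category → ℕ+ → Prop} {A₀ : tf.category}
  {hA₀ : PreFrobenioid.IsFrobeniusTrivial tf.toElem A₀} {hA₀' : SemiGraphs.IsGaloisObj A₀.base.obj}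
  {pullFrac : ∀ {A A' : (BiKummerSetting.mkOfConnectedTemperoid (C.temperedArithmeticGroup e) tf hZ hP NH A₀ hA₀ hA₀').C} (_ : A' ⟶ A),
    (BiKummerSetting.mkOfConnectedTemperoid (C.temperedArithmeticGroup e) tf hZ hP NH A₀ hA₀ hA₀').biratUnits A →
      (BiKummerSetting.mkOfConnectedTemperoid (C.temperedArithmeticGroup e) tf hZ hP NH A₀ hA₀ hA₀').biratUnits A'}
  {θ : (BiKummerSetting.mkOfConnectedTemperoid (C.temperedArithmeticGroup e) tf hZ hP NH A₀ hA₀ hA₀').biratUnits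
    (BiKummerSetting.mkOfConnectedTemperoid (C.temperedArithmeticGroup e) tf hZ hP NH A₀ hA₀ hA₀').Aodot}
  {Bl : (BiKummerSetting.mkOfConnectedTemperoid (C.temperedArithmeticGroup e) tf hZ hP NH A₀ hA₀ hA₀').C}
  {Pl : (BiKummerSetting.mkOfConnectedTemperoid (C.temperedArithmeticGroup e) tf hZ hP NH A₀ hA₀ hA₀').FractionPair θ Bl}
  {Rl : (BiKummerSetting.mkOfConnectedTemperoid (C.temperedArithmeticGroup e) tf hZ hP NH A₀ hA₀ hA₀').NthRoot θ Pl C.lPNat pullFrac}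
  (h : ModelFrobenioid.Hypotheses tf.divisorMonoid tf.ratFnFunctor)
  (Q : FrobenioidTheta.ThetaSubquotientStub.{0} (ConnectedPart (BTemp (C.temperedArithmeticGroup e).Pi)))
  (R : (BiKummerSetting.mkOfConnectedTemperoid (C.temperedArithmeticGroup e) tf hZ hP NH A₀ hA₀ hA₀').NthRoot Rl.root Rl.pair N pullFrac)
  (K' : Type) [Field K'] (constEmb : K'ˣ →* tf.biratUnitsModel R.BN) (constEmb_injective : Function.Injective constEmb)
  (hinvc : ∀ g : Aut R.AN.base,
    pull tf.divisorMonoid g.hom (ModelFrobenioid.div R.pair.num) = ModelFrobenioid.div R.pair.num)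
  (hinvp : ∀ y : (C.thetaEnvData μ hC hS).PiX, y ∈ (C.thetaEnvData μ hC hS).PiYdd →
    pull tf.divisorMonoid ((BiKummerSetting.mkOfConnectedTemperoid (C.temperedArithmeticGroup e) tf hZ hP NH A₀ hA₀ hA₀').galoisSurj
      R.AN.base R.αData.isGalois ((ContinuousMulEquiv.refl _) y)).hom (ModelFrobenioid.div R.pair.den) = ModelFrobenioid.div R.pair.den)


/-- **F-1307 `CyclotomicCharacterCompat` (the `Π^tp_Ÿ̲`-form of Prop. 5.2 (ii)/(iii) / Lemma 5.8) AT THE JUNCTION from the `tf`-side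
constants dictionary**, residual exactly that of F-1306: {`hconst`, `hK`, `ν`, `hνμ`, `hνeq`}. [cite: MochizukiEtTh2009, Lem 5.8 p.331 (PDF p.105)] -/
theorem cyclotomicCharacterCompat_ofThetaSettingData_of_constantsDictionary
    (hconst : ∀ (ε : Aut R.BN) (k : K'ˣ), tf.biratAutModel R.BN ε (constEmb k) = constEmb k)
    (hK : (ofThetaSettingData μ hC hS h Q R K' constEmb constEmb_injective hinvc hinvp).KxRootNModCyclotome)
    (m : (ofThetaSettingData μ hC hS h Q R K' constEmb constEmb_injective hinvc hinvp).muTorsion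
        (ofThetaSettingData μ hC hS h Q R K' constEmb constEmb_injective hinvc hinvp).BN
        (ofThetaSettingData μ hC hS h Q R K' constEmb constEmb_injective hinvc hinvp).N ≃* MuN p N)
    (ν : (ofThetaSettingData μ hC hS h Q R K' constEmb constEmb_injective hinvc hinvp).KxRootN →* (PadicAlgCl p)ˣ)
    (hνμ : ∀ u : (ofThetaSettingData μ hC hS h Q R K' constEmb constEmb_injective hinvc hinvp).muTorsion
        (ofThetaSettingData μ hC hS h Q R K' constEmb constEmb_injective hinvc hinvp).BN
        (ofThetaSettingData μ hC hS h Q R K' constEmb constEmb_injective hinvc hinvp).N,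
      ν ⟨(ofThetaSettingData μ hC hS h Q R K' constEmb constEmb_injective hinvc hinvp).muToBirat u,
          (ofThetaSettingData μ hC hS h Q R K' constEmb constEmb_injective hinvc hinvp).muToBirat_mem_KxRootN u⟩ =
        (rootsOfUnity N (PadicAlgCl p)).subtype (m u))
    (hνeq : ∀ (f : (ofThetaSettingData μ hC hS h Q R K' constEmb constEmb_injective hinvc hinvp).KxRootN) (y : C.Huu),
      (rootsOfUnity N (PadicAlgCl p)).subtype (m ((biratAutAction_ofConnectedTemperoidData (T := C.thetaEnvData μ hC hS) h Q C.odd_lPNat R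
          (ContinuousMulEquiv.refl _) K' constEmb constEmb_injective hinvc hinvp hconst).kummerCocycle hK f
          ((ofThetaSettingData μ hC hS h Q R K' constEmb constEmb_injective hinvc hinvp).sgpCap
            ((ofThetaSettingData μ hC hS h Q R K' constEmb constEmb_injective hinvc hinvp).ρ y)))) * ν f =
        Literature.FieldTheory.Galois.fixingSubgroupMulEquiv D.K (AlgEquiv.refl : PadicAlgCl p ≃ₐ[D.K] PadicAlgCl p)
          ((C.thetaEnvData μ hC hS).aug y) • ν f) :
    (ofThetaSettingData μ hC hS h Q R K' constEmb constEmb_injective hinvc hinvp).CyclotomicCharacterCompat (C.thetaEnvData μ hC hS)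
      (MulEquiv.refl _) m :=
  (cyclotomicCharacterCompatX_ofThetaSettingData_of_constantsDictionary μ hC hS h Q R K' constEmb constEmb_injective hinvc hinvp
    hconst hK m ν hνμ hνeq).toY

end Junction

end ThetaFrobenioid

end Literature.AnabelianGeometry.EtaleTheta

end
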